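import Literature.Barriers.CriticalPhenomena.TimarSlabs
import Literature.Barriers.CriticalPhenomena.TimarLemma42
import Literature.Barriers.CriticalPhenomena.TimarMassTransport
import Literature.Probability.Percolation.DeletionTolerance
import HarnessLib

/-!
# Timár 2006, §5 (proof of Lemma 5.2): heavy clusters have no distinguished vertices, are not
# bounded above, and infinite clusters are not bounded below — PROVED

Barrier catalogue `Literature/Barriers/CriticalPhenomena/`; a brick of the programme proving
Timár's Thm. 5.5 (`Timar2006_finiteLevelUnion`, `TimarCriticalNonunimodular.lean`). Á. Timár,
*Percolation on nonunimodular transitive graphs*, Ann. Probab. 34 (2006) 2344–2364, §5, proof of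
Lemma 5.2 ("A heavy cluster intersects every slab in infinitely many vertices"):

> "Otherwise, by deletion tolerance, with positive probability there would be a heavy cluster
> that does not have any vertex below (resp. above) a certain level. Then by insertion tolerance,
> there would also be a heavy cluster with a single lowest (resp. uppermost) vertex. Let every
> vertex of the cluster send unit mass to this vertex. This contradicts the MTP."

This file PROVES the two inner steps, on a connected, locally finite, transitive
(`IsGraphTransitive`) graph `G` (nonunimodular where long edges are needed), weights
`w = autWeight G o`, under Bernoulli(`p`) bond percolation `P_p` (any `p`):

* `measure_sel_finite_isHeavy_eq_zero` — **the MTP step, in a general form** on an abstract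
  invariant space (`TimarMassTransport.lean` setting): for an equivariant measurable selection
  `sel` of vertices, almost surely no HEAVY cluster contains a finite nonempty set of selected
  vertices ("let every vertex of the cluster send unit mass to this vertex", split equally when
  there are finitely many: the weighted mass received is the infinite total weight of the cluster,
  the mass sent is `≤ 1`; Lemma 2.2, `lintegral_tsum_eq_inv_autWeight_mul`);
* `ae_not_mem_topSel`, `ae_not_mem_botSel` — under `P_p`: almost surely no heavy cluster has a
  single uppermost vertex, and no infinite cluster has a single lowest vertex (an infinite cluster
  above its lowest vertex `x` has total weight `≥ |C| w(x) = ∞`, so it is heavy);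
* `ae_exists_lt_autWeight_of_isHeavy`, `ae_exists_autWeight_lt_of_infinite` — **the tolerance
  step**: almost surely every heavy cluster has vertices above any finite weight, and every
  infinite cluster has vertices below any positive weight. Surgery (`attachConfig`,
  `openCluster_attachConfig`): to a vertex `u` of near-maximal weight of a bounded heavy cluster
  attach its long edge up to `u₁` (`Δ w(u₁) = w(u)`, `exists_adj_mul_autWeight_eq`) and close every
  other edge at `u₁` (`G.incidenceFinset u₁`); the new cluster `C(u) ∪ {u₁}` is heavy with the single uppermost vertex `u₁`,
  an event of probability `0`, contradicting finite energy (`bondPercolation_real_pos_of_closeEdges`,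
  `bondPercolation_real_pos_of_openEdges`); symmetrically downwards.

Lemma 5.2 itself (slabs) is the next brick (`TimarLemma52.lean`).

## References

* Á. Timár, Ann. Probab. 34 (2006) 2344–2364 (arXiv:math/0702875), §5, Lemma 5.2 and its proof;
  §2 (insertion and deletion tolerance; Lemma 2.2). [Timar2006]
* R. Lyons, Y. Peres, *Probability on Trees and Networks*, CUP 2016, §8.2 ((8.10)), §7.2
  (insertion/deletion tolerance of Bernoulli percolation). [LyonsPeres2016]
-/

noncomputable section

namespace Literature.Barriers.CriticalPhenomena

open _root_.MeasureTheory Literature.Probability.Percolation SimpleGraph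
open scoped ENNReal

variable {V : Type*}

/-! ### Clusters and closed sets -/

/-- Along an open walk that starts in a set with no open edge leaving it, one stays in the set.
[folklore] -/
theorem mem_of_openWalk_of_forall_not_mem {ω : BondConfig V} {S : Set V}
    (h : ∀ u ∈ S, ∀ v, v ∉ S → s(u, v) ∉ ω) :
    ∀ {a b : V} (_ : (openGraph ω).Walk a b), a ∈ S → b ∈ S
  | _, _, .nil, ha => ha
  | a, _, .cons (v := b) hadj q, ha => by
    have hb : b ∈ S := by
      by_contra hb
      exact h a ha b hb ((openGraph_adj ω a b).1 hadj).1
    exact mem_of_openWalk_of_forall_not_mem h q hb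

/-- **A set with no open edge leaving it contains the clusters of its vertices.** [folklore] -/
theorem openCluster_subset_of_forall_not_mem {ω : BondConfig V} {S : Set V} {x : V} (hx : x ∈ S)
    (h : ∀ u ∈ S, ∀ v, v ∉ S → s(u, v) ∉ ω) : openCluster ω x ⊆ S := by
  intro y hy
  obtain ⟨p⟩ := (show (openGraph ω).Reachable x y from hy)
  exact mem_of_openWalk_of_forall_not_mem h p hx

/-! ### The selection transport: unit mass split over the selected vertices of one's cluster -/

/-- **The selection transport**: `y` sends its unit mass split equally over the selected vertices
of its cluster, `T(y, x) = |sel ∩ C(y)|⁻¹` for `x ∈ sel ∩ C(y)` ("let every vertex of the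
cluster send unit mass to this vertex"). [cite: Timar2006, Lemma 5.2 (proof: the mass transport)] -/
def selTransport (H : BondConfig V) (sel : Set V) (y x : V) : ℝ≥0∞ :=
  (sel ∩ openCluster H y).indicator (fun _ => (((sel ∩ openCluster H y).encard : ℝ≥0∞))⁻¹) x

/-- **Mass sent is at most one.** [cite: Timar2006, Lemma 5.2 (proof: unit mass)] -/
theorem tsum_selTransport_le_one (H : BondConfig V) (sel : Set V) (y : V) :
    ∑' x, selTransport H sel y x ≤ 1 := by
  simp only [selTransport]
  rw [tsum_indicator_const]
  set E : ℝ≥0∞ := ((sel ∩ openCluster H y).encard : ℝ≥0∞)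
  by_cases h0 : E = 0
  · rw [h0, zero_mul]; exact zero_le
  by_cases hT : E = ⊤
  · rw [hT, ENNReal.inv_top, mul_zero]; exact zero_le
  rw [ENNReal.mul_inv_cancel h0 hT]

/-- **Weighted mass received by a selected vertex of a heavy cluster with finitely many selected
vertices is infinite**: `Σ_y T(y, x) w(y) = W(C(x)) / |sel ∩ C(x)| = ∞`.
[cite: Timar2006, Lemma 5.2 (proof: "This contradicts the MTP")] -/
theorem tsum_selTransport_mul_eq_top {G : SimpleGraph V} {H : BondConfig V} {sel : Set V} (o : V)
    {x : V} (hx : x ∈ sel) (hfin : (sel ∩ openCluster H x).Finite)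
    (hheavy : IsHeavy G o (openCluster H x)) :
    ∑' y, selTransport H sel y x * autWeight G o y = ⊤ := by
  classical
  set E : ℝ≥0∞ := ((sel ∩ openCluster H x).encard : ℝ≥0∞) with hE
  have hET : E ≠ ⊤ := by
    rw [hE, Ne, ENat.toENNReal_eq_top, Set.encard_eq_top_iff]; exact fun h => h hfin
  have hEi : E⁻¹ ≠ 0 := ENNReal.inv_ne_zero.2 hET
  -- every `y ∈ C(x)` sends `E⁻¹` to `x`
  have hge : ∀ y, (openCluster H x).indicator (fun y => E⁻¹ * autWeight G o y) y ≤
      selTransport H sel y x * autWeight G o y := by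
    intro y
    by_cases hy : y ∈ openCluster H x
    · have hCy : openCluster H y = openCluster H x :=
        Set.ext fun z => ⟨fun hz => Reachable.trans hy hz, fun hz => Reachable.trans hy.symm hz⟩
      have hxy : x ∈ sel ∩ openCluster H y := ⟨hx, hCy ▸ mem_openCluster_self H x⟩
      rw [Set.indicator_of_mem hy, selTransport, Set.indicator_of_mem hxy, hCy]
    · rw [Set.indicator_of_notMem hy]; exact zero_le
  refine eq_top_iff.2 ?_
  calc (⊤ : ℝ≥0∞) = E⁻¹ * setWeight G o (openCluster H x) := by
        rw [show setWeight G o (openCluster H x) = ⊤ from hheavy, ENNReal.mul_top hEi]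
    _ = ∑' y, (openCluster H x).indicator (fun y => E⁻¹ * autWeight G o y) y := by
        rw [setWeight, ← ENNReal.tsum_mul_left]
        refine tsum_congr fun y => ?_
        by_cases hy : y ∈ openCluster H x
        · rw [Set.indicator_of_mem hy, Set.indicator_of_mem hy]
        · rw [Set.indicator_of_notMem hy, Set.indicator_of_notMem hy, mul_zero]
    _ ≤ ∑' y, selTransport H sel y x * autWeight G o y := ENNReal.tsum_le_tsum hge

/-! ### The MTP step on an invariant space -/

section Invariant

variable {Ω : Type*} [MeasurableSpace Ω] {G : SimpleGraph V} [G.LocallyFinite]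

omit [MeasurableSpace Ω] [G.LocallyFinite] in
/-- `selTransport` is diagonally invariant for an equivariant configuration and selection.
[folklore] -/
theorem selTransport_equivariant {act : (G ≃g G) → Ω → Ω} {H : Ω → BondConfig V}
    (hHinv : ∀ γ ξ, H (act γ ξ) = BondConfig.relabel (sym2Equiv γ.toEquiv) (H ξ))
    {sel : Ω → Set V} (hselinv : ∀ γ ξ x, γ x ∈ sel (act γ ξ) ↔ x ∈ sel ξ)
    (γ : G ≃g G) (y x : V) (ξ : Ω) :
    selTransport (H (act γ ξ)) (sel (act γ ξ)) (γ y) (γ x) = selTransport (H ξ) (sel ξ) y x := by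
  classical
  have hC : openCluster (H (act γ ξ)) (γ y) = (γ : V → V) '' openCluster (H ξ) y := by
    rw [hHinv]; exact openCluster_relabel γ.toEquiv (H ξ) y
  have hS : sel (act γ ξ) ∩ openCluster (H (act γ ξ)) (γ y) =
      (γ : V → V) '' (sel ξ ∩ openCluster (H ξ) y) := by
    rw [hC, Set.image_inter γ.injective]
    congr 1
    ext z
    constructor
    · intro hz
      refine ⟨γ.symm z, ?_, γ.apply_symm_apply z⟩
      rw [← hselinv γ ξ, γ.apply_symm_apply]; exact hz
    · rintro ⟨x', hx', rfl⟩; exact (hselinv γ ξ x').2 hx'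
  unfold selTransport
  rw [hS, γ.injective.encard_image]
  by_cases h : x ∈ sel ξ ∩ openCluster (H ξ) y
  · rw [Set.indicator_of_mem h, Set.indicator_of_mem (γ.injective.mem_set_image.2 h)]
  · rw [Set.indicator_of_notMem h, Set.indicator_of_notMem (fun h' => h (γ.injective.mem_set_image.1 h'))]

variable [Countable V]

omit [G.LocallyFinite] in
/-- The number of selected vertices in the cluster of `y` is measurable in `ξ`. [folklore] -/
theorem measurable_encard_sel_inter {H : Ω → BondConfig V} (hHm : Measurable H) {sel : Ω → Set V}
    (hselm : ∀ x, MeasurableSet {ξ | x ∈ sel ξ}) (y : V) :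
    Measurable fun ξ => ((sel ξ ∩ openCluster (H ξ) y).encard : ℝ≥0∞) := by
  have h : ∀ ξ, ((sel ξ ∩ openCluster (H ξ) y).encard : ℝ≥0∞) =
      ∑' z, (sel ξ ∩ openCluster (H ξ) y).indicator 1 z := by
    intro ξ
    rw [show (1 : V → ℝ≥0∞) = fun _ => 1 from rfl, tsum_indicator_const, mul_one]
  simp_rw [h]
  refine measurable_tsum_ennreal fun z => measurable_one.indicator ?_
  exact (hselm z).inter (measurableSet_reachable_comp hHm y z)

omit [G.LocallyFinite] in
/-- `selTransport` depends measurably on `ξ`. [folklore] -/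
theorem measurable_selTransport {H : Ω → BondConfig V} (hHm : Measurable H) {sel : Ω → Set V}
    (hselm : ∀ x, MeasurableSet {ξ | x ∈ sel ξ}) (y x : V) :
    Measurable fun ξ => selTransport (H ξ) (sel ξ) y x := by
  classical
  have h : ∀ ξ, selTransport (H ξ) (sel ξ) y x =
      ({ξ | x ∈ sel ξ} ∩ {ξ | (openGraph (H ξ)).Reachable y x}).indicator
        (fun ξ => (((sel ξ ∩ openCluster (H ξ) y).encard : ℝ≥0∞))⁻¹) ξ := by
    intro ξ
    simp only [selTransport, Set.indicator_apply, Set.mem_inter_iff, Set.mem_setOf_eq]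
    rfl
  simp_rw [h]
  exact ((measurable_encard_sel_inter hHm hselm y).inv).indicator
    ((hselm x).inter (measurableSet_reachable_comp hHm y x))

omit [G.LocallyFinite] in
/-- The event "`x` is selected, finitely many vertices of `C(x)` are, and `C(x)` is heavy" is
measurable. [folklore] -/
theorem measurableSet_sel_finite_isHeavy {H : Ω → BondConfig V} (hHm : Measurable H)
    {sel : Ω → Set V} (hselm : ∀ x, MeasurableSet {ξ | x ∈ sel ξ}) (o x : V) :
    MeasurableSet {ξ | x ∈ sel ξ ∧ (sel ξ ∩ openCluster (H ξ) x).Finite ∧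
      IsHeavy G o (openCluster (H ξ) x)} := by
  have h1 : MeasurableSet {ξ | (sel ξ ∩ openCluster (H ξ) x).Finite} := by
    have : {ξ | (sel ξ ∩ openCluster (H ξ) x).Finite} =
        {ξ | ((sel ξ ∩ openCluster (H ξ) x).encard : ℝ≥0∞) < ⊤} := by
      ext ξ
      simp only [Set.mem_setOf_eq]
      rw [ENat.toENNReal_lt_top, ← Set.encard_lt_top_iff]
    rw [this]
    exact measurableSet_lt (measurable_encard_sel_inter hHm hselm x) measurable_const
  have h2 : MeasurableSet {ξ | IsHeavy G o (openCluster (H ξ) x)} :=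
    (measurableSet_isHeavy_openCluster G o x).preimage hHm
  exact (hselm x).inter (h1.inter h2)

/-- **The MTP step of the proof of Lemma 5.2, general form, PROVED**: for a finite measure `P` on
`Ω` preserved by measurable maps `act γ` (`γ ∈ Aut(G)`, `G` connected, locally finite,
transitive), a measurable equivariant configuration `H : Ω → BondConfig V` and a measurable
equivariant selection `sel : Ω → Set V` of vertices, the event "`x` is selected, only finitely
many vertices of `C(x)` are selected, and `C(x)` is heavy" is null: the selection transport sends
mass `≤ 1` out of every vertex, while the weighted mass received by such an `x` is `∞`; Lemma 2.2
(`lintegral_tsum_eq_inv_autWeight_mul`). With `sel` = "the single uppermost vertex" this is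
Timár's "there would also be a heavy cluster with a single … uppermost vertex. Let every vertex
of the cluster send unit mass to this vertex. This contradicts the MTP."
[cite: Timar2006, Lemma 5.2 (proof: the MTP contradiction)] -/
theorem measure_sel_finite_isHeavy_eq_zero (hconn : G.Connected) (ht : IsGraphTransitive G)
    (μ : Measure Ω) [IsFiniteMeasure μ] (act : (G ≃g G) → Ω → Ω) (hact : ∀ γ, Measurable (act γ))
    (hμ : ∀ γ, μ.map (act γ) = μ) {H : Ω → BondConfig V} (hHm : Measurable H)
    (hHinv : ∀ γ ξ, H (act γ ξ) = BondConfig.relabel (sym2Equiv γ.toEquiv) (H ξ))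
    {sel : Ω → Set V} (hselm : ∀ x, MeasurableSet {ξ | x ∈ sel ξ})
    (hselinv : ∀ γ ξ x, γ x ∈ sel (act γ ξ) ↔ x ∈ sel ξ) (o x : V) :
    μ {ξ | x ∈ sel ξ ∧ (sel ξ ∩ openCluster (H ξ) x).Finite ∧
      IsHeavy G o (openCluster (H ξ) x)} = 0 := by
  classical
  set Bad := {ξ | x ∈ sel ξ ∧ (sel ξ ∩ openCluster (H ξ) x).Finite ∧
      IsHeavy G o (openCluster (H ξ) x)} with hBad
  have hBm : MeasurableSet Bad := measurableSet_sel_finite_isHeavy hHm hselm o x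
  have hmtp := lintegral_tsum_eq_inv_autWeight_mul G hconn ht μ act hact hμ
    (φ := fun y x ξ => selTransport (H ξ) (sel ξ) y x)
    (fun y x => measurable_selTransport hHm hselm y x)
    (fun γ y x ξ => selTransport_equivariant hHinv hselinv γ y x ξ) o x
  have hx0 := autWeight_ne_zero G hconn o x
  have hxT := autWeight_ne_top G hconn o x
  -- mass sent: finite
  have hsent : ∫⁻ ξ, ∑' z, selTransport (H ξ) (sel ξ) x z ∂μ < ⊤ := by
    calc ∫⁻ ξ, ∑' z, selTransport (H ξ) (sel ξ) x z ∂μ ≤ ∫⁻ _ξ, 1 ∂μ :=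
          lintegral_mono fun ξ => tsum_selTransport_le_one (H ξ) (sel ξ) x
      _ = μ Set.univ := by rw [lintegral_const, one_mul]
      _ < ⊤ := measure_lt_top μ _
  -- mass received: `∞` on `Bad`
  have hrecv : ⊤ * μ Bad ≤ ∫⁻ ξ, ∑' y, selTransport (H ξ) (sel ξ) y x * autWeight G o y ∂μ := by
    rw [← lintegral_indicator_const hBm]
    refine lintegral_mono fun ξ => ?_
    by_cases hξ : ξ ∈ Bad
    · rw [Set.indicator_of_mem hξ, tsum_selTransport_mul_eq_top o hξ.1 hξ.2.1 hξ.2.2]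
    · rw [Set.indicator_of_notMem hξ]; exact zero_le
  by_contra hne
  have htop : ⊤ * μ Bad = ⊤ := ENNReal.top_mul hne
  rw [htop, top_le_iff] at hrecv
  rw [hmtp, hrecv, ENNReal.mul_top (ENNReal.inv_ne_zero.2 hxT)] at hsent
  exact lt_irrefl _ hsent

end Invariant

/-! ### Bernoulli percolation: no single uppermost vertex of a heavy cluster, no single lowest
vertex of an infinite cluster -/

section Bernoulli

variable {G : SimpleGraph V} [G.LocallyFinite]

/-- The vertices that are the **single uppermost vertex** of their cluster: every other vertex of
`C(x)` is below `x`. [cite: Timar2006, Lemma 5.2 (proof: "a single … uppermost vertex")] -/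
def topSel (G : SimpleGraph V) (ω : BondConfig V) : Set V :=
  {x | ∀ y ∈ openCluster ω x, y ≠ x → IsAbove G x y}

/-- The vertices that are the **single lowest vertex** of their cluster.
[cite: Timar2006, Lemma 5.2 (proof: "a single lowest … vertex")] -/
def botSel (G : SimpleGraph V) (ω : BondConfig V) : Set V :=
  {x | ∀ y ∈ openCluster ω x, y ≠ x → IsAbove G y x}

omit [G.LocallyFinite] in
/-- A cluster has at most one single uppermost vertex. [folklore] -/
theorem topSel_inter_openCluster_subset (ω : BondConfig V) (x : V) (hx : x ∈ topSel G ω) :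
    topSel G ω ∩ openCluster ω x ⊆ {x} := by
  rintro x' ⟨hx', hxC⟩
  by_contra hne
  have h1 : IsAbove G x x' := hx x' hxC hne
  have h2 : IsAbove G x' x := hx' x (Reachable.symm hxC) (fun h => hne h.symm)
  exact h1.not_isAbove_symm h2

omit [G.LocallyFinite] in
/-- A cluster has at most one single lowest vertex. [folklore] -/
theorem botSel_inter_openCluster_subset (ω : BondConfig V) (x : V) (hx : x ∈ botSel G ω) :
    botSel G ω ∩ openCluster ω x ⊆ {x} := by
  rintro x' ⟨hx', hxC⟩
  by_contra hne
  have h1 : IsAbove G x' x := hx x' hxC hne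
  have h2 : IsAbove G x x' := hx' x (Reachable.symm hxC) (fun h => hne h.symm)
  exact h1.not_isAbove_symm h2

omit [G.LocallyFinite] in
/-- `topSel` is equivariant under relabelling by automorphisms. [folklore] -/
theorem mem_topSel_relabel_iff (γ : G ≃g G) (ω : BondConfig V) (x : V) :
    γ x ∈ topSel G (BondConfig.relabel (sym2Equiv γ.toEquiv) ω) ↔ x ∈ topSel G ω := by
  have hC : openCluster (BondConfig.relabel (sym2Equiv γ.toEquiv) ω) (γ x) =
      (γ : V → V) '' openCluster ω x := openCluster_relabel γ.toEquiv ω x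
  simp only [topSel, Set.mem_setOf_eq]
  rw [hC]
  constructor
  · intro h y hy hne
    have := h (γ y) ⟨y, hy, rfl⟩ (fun h' => hne (γ.injective h'))
    exact (isAbove_map_iff γ x y).1 this
  · rintro h _ ⟨y, hy, rfl⟩ hne
    exact (isAbove_map_iff γ x y).2 (h y hy (fun h' => hne (congrArg γ h')))

omit [G.LocallyFinite] in
/-- `botSel` is equivariant under relabelling by automorphisms. [folklore] -/
theorem mem_botSel_relabel_iff (γ : G ≃g G) (ω : BondConfig V) (x : V) :
    γ x ∈ botSel G (BondConfig.relabel (sym2Equiv γ.toEquiv) ω) ↔ x ∈ botSel G ω := by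
  have hC : openCluster (BondConfig.relabel (sym2Equiv γ.toEquiv) ω) (γ x) =
      (γ : V → V) '' openCluster ω x := openCluster_relabel γ.toEquiv ω x
  simp only [botSel, Set.mem_setOf_eq]
  rw [hC]
  constructor
  · intro h y hy hne
    have := h (γ y) ⟨y, hy, rfl⟩ (fun h' => hne (γ.injective h'))
    exact (isAbove_map_iff γ y x).1 this
  · rintro h _ ⟨y, hy, rfl⟩ hne
    exact (isAbove_map_iff γ y x).2 (h y hy (fun h' => hne (congrArg γ h')))

variable [Countable V]

omit [G.LocallyFinite] in
/-- `{x ∈ topSel}` is measurable. [folklore] -/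
theorem measurableSet_mem_topSel (x : V) : MeasurableSet {ω : BondConfig V | x ∈ topSel G ω} := by
  have h : {ω : BondConfig V | x ∈ topSel G ω} =
      ⋂ y, ({ω | ¬ (openGraph ω).Reachable x y} ∪ {_ω | y ≠ x → IsAbove G x y}) := by
    ext ω
    simp only [topSel, Set.mem_setOf_eq, Set.mem_iInter, Set.mem_union]
    refine forall_congr' fun y => ?_
    constructor
    · intro h; by_cases hy : (openGraph ω).Reachable x y
      · exact Or.inr (h hy)
      · exact Or.inl hy
    · rintro (h | h) hy
      · exact absurd hy h
      · exact h
  rw [h]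
  exact MeasurableSet.iInter fun y =>
    (measurableSet_setOf_reachable x y).compl.union (MeasurableSet.const _)

omit [G.LocallyFinite] in
/-- `{x ∈ botSel}` is measurable. [folklore] -/
theorem measurableSet_mem_botSel (x : V) : MeasurableSet {ω : BondConfig V | x ∈ botSel G ω} := by
  have h : {ω : BondConfig V | x ∈ botSel G ω} =
      ⋂ y, ({ω | ¬ (openGraph ω).Reachable x y} ∪ {_ω | y ≠ x → IsAbove G y x}) := by
    ext ω
    simp only [botSel, Set.mem_setOf_eq, Set.mem_iInter, Set.mem_union]
    refine forall_congr' fun y => ?_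
    constructor
    · intro h; by_cases hy : (openGraph ω).Reachable x y
      · exact Or.inr (h hy)
      · exact Or.inl hy
    · rintro (h | h) hy
      · exact absurd hy h
      · exact h
  rw [h]
  exact MeasurableSet.iInter fun y =>
    (measurableSet_setOf_reachable x y).compl.union (MeasurableSet.const _)

/-- **Almost surely no heavy cluster has a single uppermost vertex** (Bernoulli(`p`) bond
percolation on a connected, locally finite, transitive graph, any `p`).
[cite: Timar2006, Lemma 5.2 (proof: single uppermost vertex contradicts the MTP)] -/
theorem ae_not_mem_topSel (hconn : G.Connected) (ht : IsGraphTransitive G) (o : V)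
    (p : unitInterval) :
    ∀ᵐ ω ∂(bondPercolation G p), ∀ x, IsHeavy G o (openCluster ω x) → x ∉ topSel G ω := by
  rw [ae_all_iff]
  intro x
  have h0 := measure_sel_finite_isHeavy_eq_zero (Ω := BondConfig V) hconn ht (bondPercolation G p)
    (fun γ => BondConfig.relabel (sym2Equiv γ.toEquiv))
    (fun γ => (BondConfig.relabel (sym2Equiv γ.toEquiv)).measurable)
    (fun γ => bondPercolation_map_relabel_iso γ p) measurable_id (fun _ _ => rfl)
    (sel := fun ω => topSel G ω) measurableSet_mem_topSel (mem_topSel_relabel_iff) o x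
  rw [ae_iff]
  refine measure_mono_null ?_ h0
  intro ω hω
  simp only [Set.mem_setOf_eq, not_forall, not_not, exists_prop] at hω
  obtain ⟨hheavy, hx⟩ := hω
  exact ⟨hx, (Set.finite_singleton x).subset (topSel_inter_openCluster_subset ω x hx), hheavy⟩

omit [Countable V] in
/-- An infinite cluster all of whose vertices are at least as heavy as `x ∈ C` is heavy
(`W(C) ≥ |C| w(x) = ∞`). [folklore] -/
theorem isHeavy_of_infinite_of_le (hconn : G.Connected) (o : V) {C : Set V} (hC : C.Infinite)
    {x : V} (h : ∀ y ∈ C, autWeight G o x ≤ autWeight G o y) : IsHeavy G o C := by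
  rw [IsHeavy, eq_top_iff]
  have hkey := mul_encard_le_setWeight G o C (autWeight G o x)
  have hCeq : C ∩ {v | autWeight G o x ≤ autWeight G o v} = C :=
    Set.inter_eq_left.2 fun y hy => h y hy
  rw [hCeq, Set.encard_eq_top_iff.2 hC, ENat.toENNReal_top,
    ENNReal.mul_top (autWeight_ne_zero G hconn o x)] at hkey
  exact hkey

/-- **Almost surely no infinite cluster has a single lowest vertex** (such a cluster is heavy).
[cite: Timar2006, Lemma 5.2 (proof: single lowest vertex contradicts the MTP)] -/
theorem ae_not_mem_botSel (hconn : G.Connected) (ht : IsGraphTransitive G) (o : V)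
    (p : unitInterval) :
    ∀ᵐ ω ∂(bondPercolation G p), ∀ x, (openCluster ω x).Infinite → x ∉ botSel G ω := by
  rw [ae_all_iff]
  intro x
  have h0 := measure_sel_finite_isHeavy_eq_zero (Ω := BondConfig V) hconn ht (bondPercolation G p)
    (fun γ => BondConfig.relabel (sym2Equiv γ.toEquiv))
    (fun γ => (BondConfig.relabel (sym2Equiv γ.toEquiv)).measurable)
    (fun γ => bondPercolation_map_relabel_iso γ p) measurable_id (fun _ _ => rfl)
    (sel := fun ω => botSel G ω) measurableSet_mem_botSel (mem_botSel_relabel_iff) o x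
  rw [ae_iff]
  refine measure_mono_null ?_ h0
  intro ω hω
  simp only [Set.mem_setOf_eq, not_forall, not_not, exists_prop] at hω
  obtain ⟨hinf, hx⟩ := hω
  refine ⟨hx, (Set.finite_singleton x).subset (botSel_inter_openCluster_subset ω x hx), ?_⟩
  refine isHeavy_of_infinite_of_le hconn o hinf (x := x) fun y hy => ?_
  by_cases hyx : y = x
  · rw [hyx]
  · exact ((isAbove_iff_autWeight_lt G hconn o y x).1 (hx y hy hyx)).le

/-! ### Surgery: attaching one long edge and isolating its far end -/

/-- **The surgery**: close every edge of `G` at `u₁` (Mathlib's `incidenceFinset`), then open the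
edge `{u, u₁}` ("by insertion tolerance, there would also be a heavy cluster with a single lowest
(resp. uppermost) vertex"). [cite: Timar2006, Lemma 5.2 (proof: insertion and deletion tolerance)] -/
def attachConfig (G : SimpleGraph V) [G.LocallyFinite] (u u₁ : V) (ω : BondConfig V) :
    BondConfig V :=
  open Classical in
  openEdges (↑({s(u, u₁)} : Finset (Sym2 V))) (closeEdges ↑(G.incidenceFinset u₁) ω)

omit [Countable V] in
/-- **After the surgery the cluster of `u₁` is `C(u) ∪ {u₁}`** (`ω ⊆ E(G)`, `u ∼ u₁`,
`u₁ ∉ C(u)`): no open edge leaves `C(u) ∪ {u₁}`, and the open paths of `C(u)` avoid `u₁`.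
[cite: Timar2006, Lemma 5.2 (proof: the modified cluster)] -/
theorem openCluster_attachConfig {ω : BondConfig V} (hω : ω ⊆ G.edgeSet) {u u₁ : V}
    (hadj : G.Adj u u₁) (hu₁ : u₁ ∉ openCluster ω u) :
    openCluster (attachConfig G u u₁ ω) u₁ = insert u₁ (openCluster ω u) := by
  classical
  have hω' : attachConfig G u u₁ ω = (ω \ ↑(G.incidenceFinset u₁)) ∪ {s(u, u₁)} := by
    rw [attachConfig, openEdges, closeEdges, Finset.coe_singleton]
  have hinc : ∀ e : Sym2 V, e ∈ (↑(G.incidenceFinset u₁) : Set (Sym2 V)) ↔ e ∈ G.edgeSet ∧ u₁ ∈ e :=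
    fun e => by rw [Finset.mem_coe, SimpleGraph.mem_incidenceFinset]; rfl
  refine Set.Subset.antisymm ?_ ?_
  · -- no open edge leaves `C(u) ∪ {u₁}`
    refine openCluster_subset_of_forall_not_mem (Set.mem_insert u₁ _) ?_
    intro a ha b hb hab
    rw [hω'] at hab
    rcases hab with ⟨habω, habE⟩ | hab
    · have hG : s(a, b) ∈ G.edgeSet := hω habω
      have hu₁ab : u₁ ∉ s(a, b) := fun h => habE ((hinc _).2 ⟨hG, h⟩)
      have hau : a ≠ u₁ := fun h => hu₁ab (h ▸ Sym2.mem_mk_left a b)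
      have haC : a ∈ openCluster ω u := by
        rcases (Set.mem_insert_iff.1 ha) with h | h
        · exact absurd h hau
        · exact h
      have hbC : b ∈ openCluster ω u :=
        (show (openGraph ω).Reachable u a from haC).trans
          (Adj.reachable ((openGraph_adj ω a b).2 ⟨habω, G.ne_of_adj (G.mem_edgeSet.1 hG)⟩))
      exact hb (Set.mem_insert_of_mem _ hbC)
    · rw [Set.mem_singleton_iff] at hab
      rcases Sym2.eq_iff.1 hab with ⟨rfl, rfl⟩ | ⟨rfl, rfl⟩
      · exact hb (Set.mem_insert _ _)
      · exact hb (Set.mem_insert_of_mem _ (mem_openCluster_self ω _))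
  · -- `u₁`, and `C(u)` through the new edge
    have hle : ω \ ↑(G.incidenceFinset u₁) ⊆ attachConfig G u u₁ ω := by
      rw [hω']; exact Set.subset_union_left
    have hCu : openCluster ω u ⊆ openCluster (ω \ ↑(G.incidenceFinset u₁)) u := by
      refine openCluster_subset_of_forall_not_mem (mem_openCluster_self _ u) ?_
      intro a ha b hb hab
      have haω : a ∈ openCluster ω u := openCluster_mono (fun _ h => h.1) u ha
      by_cases hE : s(a, b) ∈ (↑(G.incidenceFinset u₁) : Set (Sym2 V))
      · -- an edge at `u₁` open in `ω` from `C(u)` would put `u₁` in `C(u)`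
        have hG : s(a, b) ∈ G.edgeSet := ((hinc _).1 hE).1
        have hne : a ≠ b := G.ne_of_adj (G.mem_edgeSet.1 hG)
        have hbω : b ∈ openCluster ω u :=
          (show (openGraph ω).Reachable u a from haω).trans
            (Adj.reachable ((openGraph_adj ω a b).2 ⟨hab, hne⟩))
        have hu₁ab : u₁ ∈ s(a, b) := ((hinc _).1 hE).2
        rcases Sym2.mem_iff.1 hu₁ab with h | h
        · exact hu₁ (h ▸ haω)
        · exact hu₁ (h ▸ hbω)
      · have hG : s(a, b) ∈ G.edgeSet := hω hab
        exact hb ((show (openGraph (ω \ ↑(G.incidenceFinset u₁))).Reachable u a from ha).trans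
          (Adj.reachable ((openGraph_adj _ a b).2 ⟨⟨hab, hE⟩, G.ne_of_adj (G.mem_edgeSet.1 hG)⟩)))
    have hedge : (openGraph (attachConfig G u u₁ ω)).Adj u₁ u := by
      rw [openGraph_adj, hω']
      exact ⟨Or.inr (by rw [Set.mem_singleton_iff, Sym2.eq_swap]), hadj.ne.symm⟩
    intro y hy
    rcases Set.mem_insert_iff.1 hy with rfl | hy
    · exact mem_openCluster_self _ _
    · exact hedge.reachable.trans ((show (openGraph _).Reachable u y from hCu hy).mono
        (openGraph_mono hle))

/-! ### The tolerance step: heavy clusters are not bounded above -/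

/-- **The event of the upward surgery is null**: for adjacent `u, u₁` with `Δ w(u₁) = w(u)`,
almost surely it does not happen that `C(u)` is heavy with all weights `< w(u₁)` — after the
surgery `C(u) ∪ {u₁}` would be a heavy cluster with the single uppermost vertex `u₁`
(`ae_not_mem_topSel`), and finite energy transports positivity.
[cite: Timar2006, Lemma 5.2 (proof: deletion and insertion tolerance)] -/
theorem measure_upEvent_eq_zero (hconn : G.Connected) (ht : IsGraphTransitive G) (o : V)
    (p : unitInterval) {u u₁ : V} (hadj : G.Adj u u₁) :
    bondPercolation G p {ω | ω ⊆ G.edgeSet ∧ IsHeavy G o (openCluster ω u) ∧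
      ∀ y ∈ openCluster ω u, autWeight G o y < autWeight G o u₁} = 0 := by
  classical
  set μ := bondPercolation G p with hμ
  set A := {ω : BondConfig V | ω ⊆ G.edgeSet ∧ IsHeavy G o (openCluster ω u) ∧
      ∀ y ∈ openCluster ω u, autWeight G o y < autWeight G o u₁} with hA
  -- `u₁ ∉ C(u)` on `A`
  have hu₁ : ∀ ω ∈ A, u₁ ∉ openCluster ω u := fun ω hω h => lt_irrefl _ (hω.2.2 u₁ h)
  rcases eq_or_ne p 0 with hp0 | hp0
  · -- `p = 0`: no infinite clusters, so no heavy ones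
    have h0 : ∀ᵐ ω ∂μ, numInfiniteClusters ω = 0 := by
      rw [hμ, hp0]; exact ae_numInfiniteClusters_eq_zero_bot G
    refine measure_mono_null (fun ω hω => ?_) (ae_iff.1 h0)
    intro h
    exact (numInfiniteClusters_ne_zero_iff ω).2 ⟨u, hω.2.1.infinite hconn⟩ h
  rcases eq_or_ne p 1 with hp1 | hp1
  · -- `p = 1`: the edge `uu₁` is open, `u₁ ∈ C(u)`
    have h1 : ∀ᵐ ω ∂μ, ∀ e ∈ G.edgeSet, e ∈ ω := by rw [hμ, hp1]; exact ae_forall_mem_of_one G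
    refine measure_mono_null (fun ω hω => ?_) (ae_iff.1 h1)
    intro h
    exact hu₁ ω hω (Adj.reachable ((openGraph_adj ω u u₁).2 ⟨h _ (G.mem_edgeSet.2 hadj), hadj.ne⟩))
  -- `0 < p < 1`: finite energy
  have hp0' : 0 < (p : ℝ) := lt_of_le_of_ne p.2.1 (fun h => hp0 (Subtype.ext h.symm))
  have hp1' : (p : ℝ) < 1 := lt_of_le_of_ne p.2.2 (fun h => hp1 (Subtype.ext h))
  by_contra hne
  have hpos : 0 < μ.real A := by
    rw [measureReal_def]; exact ENNReal.toReal_pos hne (measure_ne_top _ _)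
  set T := {ω : BondConfig V | IsHeavy G o (openCluster ω u₁) ∧ u₁ ∈ topSel G ω} with hT
  have hTm : MeasurableSet T := (measurableSet_isHeavy_openCluster G o u₁).inter (measurableSet_mem_topSel u₁)
  have hT0 : μ T = 0 := by
    refine measure_mono_null ?_ (ae_iff.1 (ae_not_mem_topSel hconn ht o p))
    intro ω hω h
    exact h u₁ hω.1 hω.2
  -- the surgery maps `A` into `T`
  have hmap : ∀ ω ∈ A, attachConfig G u u₁ ω ∈ T := by
    intro ω hω
    have hC := openCluster_attachConfig hω.1 hadj (hu₁ ω hω)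
    refine ⟨?_, ?_⟩
    · rw [hC]; exact hω.2.1.mono (Set.subset_insert _ _)
    · intro y hy hne'
      rw [hC] at hy
      rcases Set.mem_insert_iff.1 hy with h | h
      · exact absurd h hne'
      · exact (isAbove_iff_autWeight_lt G hconn o u₁ y).2 (hω.2.2 y h)
  set E₁ := openEdges (↑({s(u, u₁)} : Finset (Sym2 V))) ⁻¹' T with hE₁
  have hE₁m : MeasurableSet E₁ := measurable_openEdges _ hTm
  have hpos₁ : 0 < μ.real E₁ :=
    bondPercolation_real_pos_of_closeEdges G hp1' (G.incidenceFinset u₁) hE₁m hpos fun ω hω => hmap ω hω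
  have hposT : 0 < μ.real T :=
    bondPercolation_real_pos_of_openEdges G hp0' {s(u, u₁)}
      (by rw [Finset.coe_singleton, Set.singleton_subset_iff]; exact G.mem_edgeSet.2 hadj)
      hTm hpos₁ fun ω hω => hω
  rw [measureReal_def, hT0, ENNReal.toReal_zero] at hposT
  exact lt_irrefl _ hposT

/-- **Almost surely a heavy cluster is not bounded above** ("with positive probability there
would be a heavy cluster that does not have any vertex … above a certain level" is impossible):
under Bernoulli(`p`) bond percolation on a connected, locally finite, transitive nonunimodular
graph, almost surely every heavy cluster contains vertices of weight above any finite bound.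
Proof: otherwise let `S < ∞` be the supremum of the weights on `C(x)`; some `u ∈ C(x)` has
`w(u) > Δ S`, its neighbour `u₁` one long edge up (`exists_adj_mul_autWeight_eq`) has
`w(u₁) = w(u)/Δ > S`, and the null event of `measure_upEvent_eq_zero` happens.
[cite: Timar2006, Lemma 5.2 (proof: no heavy cluster without vertices above a level)] -/
theorem ae_exists_lt_autWeight_of_isHeavy (hconn : G.Connected) (ht : IsGraphTransitive G)
    (hU : ¬ IsGraphUnimodular G) (o : V) (p : unitInterval) :
    ∀ᵐ ω ∂(bondPercolation G p), ∀ x, IsHeavy G o (openCluster ω x) →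
      ∀ M : ℝ≥0∞, M ≠ ⊤ → ∃ y ∈ openCluster ω x, M < autWeight G o y := by
  classical
  have hae : ∀ᵐ ω ∂(bondPercolation G p), ∀ u u₁, G.Adj u u₁ →
      ¬ (ω ⊆ G.edgeSet ∧ IsHeavy G o (openCluster ω u) ∧
        ∀ y ∈ openCluster ω u, autWeight G o y < autWeight G o u₁) := by
    rw [ae_all_iff]; intro u
    rw [ae_all_iff]; intro u₁
    by_cases hadj : G.Adj u u₁
    · have h := measure_upEvent_eq_zero hconn ht o p hadj
      rw [ae_iff]
      refine measure_mono_null (fun ω hω => ?_) h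
      simp only [Set.mem_setOf_eq, not_forall, not_not, exists_prop] at hω
      exact hω.2
    · exact ae_of_all _ fun ω h => absurd h hadj
  filter_upwards [hae, (ProbabilityTheory.setBernoulli_ae_subset : ∀ᵐ ω ∂(bondPercolation G p), ω ⊆ G.edgeSet)]
    with ω hω hE x hx M hM
  by_contra hno
  push Not at hno
  set S : ℝ≥0∞ := ⨆ y ∈ openCluster ω x, autWeight G o y with hS
  have hSM : S ≤ M := iSup₂_le hno
  have hST : S ≠ ⊤ := ne_top_of_le_ne_top hM hSM
  have hxS : autWeight G o x ≤ S := le_iSup₂ (f := fun y (_ : y ∈ openCluster ω x) => autWeight G o y)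
    x (mem_openCluster_self ω x)
  have hS0 : S ≠ 0 := fun h => autWeight_ne_zero G hconn o x (le_zero_iff.1 (h ▸ hxS))
  have hΔ0 := minNbrWeight_ne_zero hconn o
  have hΔT := minNbrWeight_ne_top hconn ht hU o
  have hΔS : minNbrWeight G o * S < S := by
    calc minNbrWeight G o * S < 1 * S :=
          ENNReal.mul_lt_mul_left hS0 hST (minNbrWeight_lt_one hconn ht hU o)
      _ = S := one_mul S
  obtain ⟨u, hu, hΔu⟩ : ∃ u ∈ openCluster ω x, minNbrWeight G o * S < autWeight G o u := by
    simpa only [hS, lt_iSup_iff, exists_prop] using hΔS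
  obtain ⟨u₁, hadj, hu₁⟩ := exists_adj_mul_autWeight_eq hconn ht hU o u
  have hCu : openCluster ω u = openCluster ω x :=
    Set.ext fun z => ⟨fun hz => Reachable.trans hu hz, fun hz => Reachable.trans hu.symm hz⟩
  refine hω u u₁ hadj ⟨hE, ?_, fun y hy => ?_⟩
  · rwa [hCu]
  · rw [hCu] at hy
    calc autWeight G o y ≤ S := le_iSup₂ (f := fun y (_ : y ∈ openCluster ω x) => autWeight G o y) y hy
      _ < autWeight G o u₁ := by
          rw [← hu₁] at hΔu
          exact (ENNReal.mul_lt_mul_iff_right hΔ0 hΔT).1 hΔu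

/-! ### The tolerance step: infinite clusters are not bounded below -/

/-- **The event of the downward surgery is null**: for adjacent `u, u₁` with `w(u₁) = Δ w(u)`,
almost surely it does not happen that `C(u)` is infinite with all weights `> w(u₁)` — after the
surgery `C(u) ∪ {u₁}` would be an infinite cluster with the single lowest vertex `u₁`
(`ae_not_mem_botSel`). [cite: Timar2006, Lemma 5.2 (proof: deletion and insertion tolerance)] -/
theorem measure_downEvent_eq_zero (hconn : G.Connected) (ht : IsGraphTransitive G) (o : V)
    (p : unitInterval) {u u₁ : V} (hadj : G.Adj u u₁) :
    bondPercolation G p {ω | ω ⊆ G.edgeSet ∧ (openCluster ω u).Infinite ∧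
      ∀ y ∈ openCluster ω u, autWeight G o u₁ < autWeight G o y} = 0 := by
  classical
  set μ := bondPercolation G p with hμ
  set A := {ω : BondConfig V | ω ⊆ G.edgeSet ∧ (openCluster ω u).Infinite ∧
      ∀ y ∈ openCluster ω u, autWeight G o u₁ < autWeight G o y} with hA
  have hu₁ : ∀ ω ∈ A, u₁ ∉ openCluster ω u := fun ω hω h => lt_irrefl _ (hω.2.2 u₁ h)
  rcases eq_or_ne p 0 with hp0 | hp0
  · have h0 : ∀ᵐ ω ∂μ, numInfiniteClusters ω = 0 := by
      rw [hμ, hp0]; exact ae_numInfiniteClusters_eq_zero_bot G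
    refine measure_mono_null (fun ω hω => ?_) (ae_iff.1 h0)
    intro h
    exact (numInfiniteClusters_ne_zero_iff ω).2 ⟨u, hω.2.1⟩ h
  rcases eq_or_ne p 1 with hp1 | hp1
  · have h1 : ∀ᵐ ω ∂μ, ∀ e ∈ G.edgeSet, e ∈ ω := by rw [hμ, hp1]; exact ae_forall_mem_of_one G
    refine measure_mono_null (fun ω hω => ?_) (ae_iff.1 h1)
    intro h
    exact hu₁ ω hω (Adj.reachable ((openGraph_adj ω u u₁).2 ⟨h _ (G.mem_edgeSet.2 hadj), hadj.ne⟩))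
  have hp0' : 0 < (p : ℝ) := lt_of_le_of_ne p.2.1 (fun h => hp0 (Subtype.ext h.symm))
  have hp1' : (p : ℝ) < 1 := lt_of_le_of_ne p.2.2 (fun h => hp1 (Subtype.ext h))
  by_contra hne
  have hpos : 0 < μ.real A := by
    rw [measureReal_def]; exact ENNReal.toReal_pos hne (measure_ne_top _ _)
  set T := {ω : BondConfig V | (openCluster ω u₁).Infinite ∧ u₁ ∈ botSel G ω} with hT
  have hTm : MeasurableSet T :=
    (measurableSet_percolatesAt_holds (V := V) u₁).inter (measurableSet_mem_botSel u₁)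
  have hT0 : μ T = 0 := by
    refine measure_mono_null ?_ (ae_iff.1 (ae_not_mem_botSel hconn ht o p))
    intro ω hω h
    exact h u₁ hω.1 hω.2
  have hmap : ∀ ω ∈ A, attachConfig G u u₁ ω ∈ T := by
    intro ω hω
    have hC := openCluster_attachConfig hω.1 hadj (hu₁ ω hω)
    refine ⟨?_, ?_⟩
    · rw [hC]; exact hω.2.1.mono (Set.subset_insert _ _)
    · intro y hy hne'
      rw [hC] at hy
      rcases Set.mem_insert_iff.1 hy with h | h
      · exact absurd h hne'
      · exact (isAbove_iff_autWeight_lt G hconn o y u₁).2 (hω.2.2 y h)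
  set E₁ := openEdges (↑({s(u, u₁)} : Finset (Sym2 V))) ⁻¹' T with hE₁
  have hE₁m : MeasurableSet E₁ := measurable_openEdges _ hTm
  have hpos₁ : 0 < μ.real E₁ :=
    bondPercolation_real_pos_of_closeEdges G hp1' (G.incidenceFinset u₁) hE₁m hpos fun ω hω => hmap ω hω
  have hposT : 0 < μ.real T :=
    bondPercolation_real_pos_of_openEdges G hp0' {s(u, u₁)}
      (by rw [Finset.coe_singleton, Set.singleton_subset_iff]; exact G.mem_edgeSet.2 hadj)
      hTm hpos₁ fun ω hω => hω
  rw [measureReal_def, hT0, ENNReal.toReal_zero] at hposT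
  exact lt_irrefl _ hposT

/-- **Almost surely an infinite cluster is not bounded below** ("a heavy cluster that does not
have any vertex below … a certain level" is impossible; infinite suffices): under Bernoulli(`p`)
bond percolation on a connected, locally finite, transitive nonunimodular graph, almost surely
every infinite cluster contains vertices of weight below any positive bound. Proof: with
`I > 0` the infimum of the weights on `C(x)`, some `u ∈ C(x)` has `w(u) < I/Δ`, its neighbour
`u₁` one long edge down (`exists_adj_autWeight_eq_mul`) has `w(u₁) = Δ w(u) < I`, and the null
event of `measure_downEvent_eq_zero` happens.
[cite: Timar2006, Lemma 5.2 (proof: no heavy cluster without vertices below a level)] -/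
theorem ae_exists_autWeight_lt_of_infinite (hconn : G.Connected) (ht : IsGraphTransitive G)
    (hU : ¬ IsGraphUnimodular G) (o : V) (p : unitInterval) :
    ∀ᵐ ω ∂(bondPercolation G p), ∀ x, (openCluster ω x).Infinite →
      ∀ m : ℝ≥0∞, m ≠ 0 → ∃ y ∈ openCluster ω x, autWeight G o y < m := by
  classical
  have hae : ∀ᵐ ω ∂(bondPercolation G p), ∀ u u₁, G.Adj u u₁ →
      ¬ (ω ⊆ G.edgeSet ∧ (openCluster ω u).Infinite ∧
        ∀ y ∈ openCluster ω u, autWeight G o u₁ < autWeight G o y) := by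
    rw [ae_all_iff]; intro u
    rw [ae_all_iff]; intro u₁
    by_cases hadj : G.Adj u u₁
    · have h := measure_downEvent_eq_zero hconn ht o p hadj
      rw [ae_iff]
      refine measure_mono_null (fun ω hω => ?_) h
      simp only [Set.mem_setOf_eq, not_forall, not_not, exists_prop] at hω
      exact hω.2
    · exact ae_of_all _ fun ω h => absurd h hadj
  filter_upwards [hae, (ProbabilityTheory.setBernoulli_ae_subset : ∀ᵐ ω ∂(bondPercolation G p), ω ⊆ G.edgeSet)]
    with ω hω hE x hx m hm
  by_contra hno
  push Not at hno
  set I : ℝ≥0∞ := ⨅ y ∈ openCluster ω x, autWeight G o y with hI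
  have hmI : m ≤ I := le_iInf₂ hno
  have hI0 : I ≠ 0 := fun h => hm (le_zero_iff.1 (h ▸ hmI))
  have hIx : I ≤ autWeight G o x := iInf₂_le (f := fun y (_ : y ∈ openCluster ω x) => autWeight G o y)
    x (mem_openCluster_self ω x)
  have hIT : I ≠ ⊤ := ne_top_of_le_ne_top (autWeight_ne_top G hconn o x) hIx
  have hΔ0 := minNbrWeight_ne_zero hconn o
  have hΔT := minNbrWeight_ne_top hconn ht hU o
  -- `I < Δ⁻¹ I`
  have hΔI : I < (minNbrWeight G o)⁻¹ * I := by
    calc I = 1 * I := (one_mul I).symm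
      _ < (minNbrWeight G o)⁻¹ * I :=
          ENNReal.mul_lt_mul_left hI0 hIT
            (ENNReal.one_lt_inv.2 (minNbrWeight_lt_one hconn ht hU o))
  obtain ⟨u, hu, hΔu⟩ : ∃ u ∈ openCluster ω x, autWeight G o u < (minNbrWeight G o)⁻¹ * I := by
    simpa only [hI, iInf_lt_iff, exists_prop] using hΔI
  obtain ⟨u₁, hadj, hu₁⟩ := exists_adj_autWeight_eq_mul hconn ht hU o u
  have hCu : openCluster ω u = openCluster ω x :=
    Set.ext fun z => ⟨fun hz => Reachable.trans hu hz, fun hz => Reachable.trans hu.symm hz⟩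
  refine hω u u₁ hadj ⟨hE, ?_, fun y hy => ?_⟩
  · rwa [hCu]
  · rw [hCu] at hy
    calc autWeight G o u₁ = minNbrWeight G o * autWeight G o u := hu₁
      _ < minNbrWeight G o * ((minNbrWeight G o)⁻¹ * I) := ENNReal.mul_lt_mul_right hΔ0 hΔT hΔu
      _ = I := by rw [← mul_assoc, ENNReal.mul_inv_cancel hΔ0 hΔT, one_mul]
      _ ≤ autWeight G o y := iInf₂_le (f := fun y (_ : y ∈ openCluster ω x) => autWeight G o y) y hy

end Bernoulli

end Literature.Barriers.CriticalPhenomena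

end
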